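import Summits.BirchSwinnertonDyer.BirchSwinnertonDyer.Theorems.GenusKolyvaginAtTwoGenusPrimitiveSupplyAtTwoGenusReductionComposite
import Summits.BirchSwinnertonDyer.Rank1Residual.X11b.KolyvaginHeegnerTower
import Summits.BirchSwinnertonDyer.Rank1Residual.X11b.KolyvaginRingClassCardinality
import Literature.NumberTheory.EllipticCurves.RingClassGenusCharacterProofs

/-!
# Route `GenusKolyvaginAtTwo`, crux `GenusPrimitiveSupplyAtTwo` (stmt-BirchSwinnertonDyer-22136), line `genus-supply`:
# `G_n = ∏_{ℓ ∣ n} G_ℓ` as a MULTI-INDEX BIJECTION — every element of `Gal(K[n]/K[1])` is uniquely `∏ σ_ℓ^{i_ℓ}`, `i_ℓ ≤ ℓ`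

Lead prover seat bsd-line-gk2-p1 (g2). Ring-class-tower plumbing for the composite-level INTRINSIC genus dictionary (next
file): Gross 1991 §3 «`G_n ≃ ∏_{ℓ∣n} G_ℓ`, `G_ℓ` cyclic of order `ℓ + 1`, generator `σ_ℓ`» for `K` imaginary quadratic with
`d_K < −4`, `n` square-free with inert prime factors, on the tree's `K[n] ⊂ ℂ`. With the iterated image
`SPAN σ L := L.foldr (fun ℓ T ↦ (range (ℓ+1) ×ˢ T).image (fun p ↦ σ ℓ ^ p.1 * p.2)) {1}` (products `∏ σ_ℓ^{i_ℓ}`, `i_ℓ ≤ ℓ`,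
along a list `L`; written out, no definition): §1 COUNTING `[K[n]:K] = ∏(ℓ+1)·[K[1]:K]`, `#G_n = ∏(ℓ+1)` (x11b3's
`card_ringClassGalOver_eq_succ`, `card_ringClassGalOver_mul_finrank`); §2 GENERATION `Gal(K[n]/K[n/m]) ⊆ SPAN σ (factors of m)`
(Galois side of lit2's `RingClass.ker_restrict_div_le_sup` via x11b3's `exists_mul_eq_of_mem_ringClassGalOver`); §3 INJECTIVITY
of each stage map `(i,t) ↦ σ_ℓ^i·t` on `range(ℓ+1) × SPAN(L')`, by counting; §4 GENUS RADICALS `θ_ℓ = √ℓ* ∈ K[n]` with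
`σ_ℓ θ_ℓ = −θ_ℓ`, `σ_ℓ' θ_ℓ = θ_ℓ` (`ℓ' ≠ ℓ`). Helper for the crux item (`--supports stmt-BirchSwinnertonDyer-22136`, helper
mode). No summit and no leaf is proved by this file; BSD is not proved by any of this.
-/

set_option linter.dupNamespace false -- tree convention: `Summit.BirchSwinnertonDyer.BirchSwinnertonDyer.Theorems` (summit = sub-problem)

noncomputable section

open scoped Classical

namespace Summit.BirchSwinnertonDyer.BirchSwinnertonDyer.Theorems.GenusKoly

open Finset Module NumberField WeierstrassCurve Literature.NumberTheory.EllipticCurves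
  Literature.NumberTheory.QuadraticFields Literature.NumberTheory.QuadraticFields.RingClass
  Summit.BirchSwinnertonDyer.Rank1Residual.X11b.RingClassTower

variable {K : Type} [Field K] [NumberField K]

/-! ## §0 Lists of distinct prime factors -/

/-- A duplicate-free list of primes dividing `n` has product dividing `n`. [folklore] -/
theorem prod_dvd_of_nodup_of_forall_mem_primeFactors {n : ℕ} {L : List ℕ} (hL : L.Nodup)
    (hmem : ∀ ℓ ∈ L, ℓ ∈ n.primeFactors) : L.prod ∣ n := by
  have h := Finset.prod_primes_dvd n (s := L.toFinset)
    (fun p hp ↦ Nat.prime_iff.mp (Nat.prime_of_mem_primeFactors (hmem p (List.mem_toFinset.mp hp))))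
    (fun p hp ↦ Nat.dvd_of_mem_primeFactors (hmem p (List.mem_toFinset.mp hp)))
  have h' : ∏ p ∈ L.toFinset, p = L.prod := by
    rw [List.prod_toFinset (fun p : ℕ ↦ p) hL]
    simp
  rwa [h'] at h

/-- The head of a duplicate-free list of primes does not divide the product of the tail. [folklore] -/
theorem not_dvd_prod_of_nodup_cons {n : ℕ} {ℓ : ℕ} {L : List ℕ} (hL : (ℓ :: L).Nodup)
    (hmem : ∀ q ∈ ℓ :: L, q ∈ n.primeFactors) : ¬ ℓ ∣ L.prod := by
  intro h
  have hℓ : ℓ.Prime := Nat.prime_of_mem_primeFactors (hmem ℓ List.mem_cons_self)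
  obtain ⟨a, ha, hℓa⟩ := (Prime.dvd_prod_iff (Nat.prime_iff.mp hℓ)).mp h
  have haP : a.Prime := Nat.prime_of_mem_primeFactors (hmem a (List.mem_cons_of_mem ℓ ha))
  have : ℓ = a := (Nat.prime_dvd_prime_iff_eq hℓ haP).mp hℓa
  exact (List.nodup_cons.mp hL).1 (this ▸ ha)

/-! ## §1 Counting: `[K[n] : K] = ∏ (ℓ+1) · [K[1] : K]` and `#G_n = ∏ (ℓ+1)` -/

/-- **`[K[m] : K] = ∏_{ℓ∣m} (ℓ+1) · [K[1] : K]`** for `m` a product of distinct primes inert in `K` (`d_K < −4`): iterate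
`[K[ℓm′] : K[m′]] = ℓ + 1` (Gross 1991 §3 «`G_ℓ` cyclic of order `ℓ+1`»; tree `card_ringClassGalOver_eq_succ`,
`card_ringClassGalOver_mul_finrank`). [cite: GrossLMS1991, §3 (G_n ≃ ∏ G_ℓ, #G_ℓ = ℓ+1)] [cite: Cox2013, §7.D Thm. 7.24] -/
theorem finrank_ringClassField_prod_eq (hK : IsImaginaryQuadratic K) (ι : K →+* ℂ) (hD : NumberField.discr K < -4)
    {n : ℕ} (L : List ℕ) (hL : L.Nodup) (hmem : ∀ ℓ ∈ L, ℓ ∈ n.primeFactors)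
    (hinert : ∀ ℓ ∈ L, (Ideal.span {(ℓ : 𝓞 K)}).IsPrime) :
    finrank K (ringClassField K ι L.prod) = (L.map (· + 1)).prod * finrank K (ringClassField K ι 1) := by
  induction L with
  | nil =>
    show finrank K (ringClassField K ι 1) = (([] : List ℕ).map (· + 1)).prod * finrank K (ringClassField K ι 1)
    simp
  | cons ℓ L ih =>
    have hL' : L.Nodup := (List.nodup_cons.mp hL).2
    have hmem' : ∀ q ∈ L, q ∈ n.primeFactors := fun q hq ↦ hmem q (List.mem_cons_of_mem ℓ hq)
    have hinert' : ∀ q ∈ L, (Ideal.span {(q : 𝓞 K)}).IsPrime := fun q hq ↦ hinert q (List.mem_cons_of_mem ℓ hq)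
    have hℓ : ℓ.Prime := Nat.prime_of_mem_primeFactors (hmem ℓ List.mem_cons_self)
    have hm0 : L.prod ≠ 0 := List.prod_ne_zero (fun h ↦ (Nat.prime_of_mem_primeFactors (hmem' 0 h)).ne_zero rfl)
    have hℓm : ¬ ℓ ∣ L.prod := not_dvd_prod_of_nodup_cons hL hmem
    have h1 := card_ringClassGalOver_eq_succ hK ι hℓ (hinert ℓ List.mem_cons_self) hℓm hm0 (Or.inr hD)
    have h2 := card_ringClassGalOver_mul_finrank hK ι (dvd_mul_left L.prod ℓ) (mul_ne_zero hℓ.ne_zero hm0)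
    rw [h1, ih hL' hmem' hinert'] at h2
    rw [List.prod_cons, List.map_cons, List.prod_cons, ← h2, mul_assoc]

/-- **`#G_n = #Gal(K[n]/K[1]) = ∏_{ℓ∣n} (ℓ+1)`** for `n` square-free with every prime factor inert in `K`, `d_K < −4`
(`#G_n · [K[1]:K] = [K[n]:K]`, tree `card_ringClassGalOver_mul_finrank`, and §1). [cite: GrossLMS1991, §3–§4 (0 → G_n → 𝒢_n → Gal(K_1/K) → 0)] -/
theorem natCard_ringClassGalOver_one_eq_prod (hK : IsImaginaryQuadratic K) (ι : K →+* ℂ)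
    (hD : NumberField.discr K < -4) {n : ℕ} (hn : Squarefree n)
    (hinert : ∀ ℓ ∈ n.primeFactors, (Ideal.span {(ℓ : 𝓞 K)}).IsPrime) :
    Nat.card (ringClassGalOver ι n 1) = (n.primeFactorsList.map (· + 1)).prod := by
  have hn0 : n ≠ 0 := hn.ne_zero
  have h := card_ringClassGalOver_mul_finrank hK ι (one_dvd n) hn0
  have hprod := finrank_ringClassField_prod_eq hK ι hD n.primeFactorsList
    ((Nat.squarefree_iff_nodup_primeFactorsList hn0).mp hn) (fun ℓ hℓ ↦ List.mem_toFinset.mpr hℓ)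
    (fun ℓ hℓ ↦ hinert ℓ (List.mem_toFinset.mpr hℓ))
  rw [Nat.prod_primeFactorsList hn0] at hprod
  rw [hprod] at h
  haveI := (finiteDimensional_and_isGalois_ringClassField hK ι one_ne_zero).1
  have hpos : 0 < finrank K (ringClassField K ι 1) := finrank_pos
  exact Nat.eq_of_mul_eq_mul_right hpos h

/-! ## §2 Generation: `Gal(K[n]/K[n/m]) ⊆ SPAN σ (prime factors of m)` -/

/-- `SPAN σ L ⊆ G_n`: a product of powers of the generators `σ_ℓ` (`ℓ ∣ n`) lies in `Gal(K[n]/K[1])` (each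
`G_ℓ = Gal(K[n]/K[n/ℓ]) ≤ Gal(K[n]/K[1])`). [cite: GrossLMS1991, §3 (G_ℓ ≤ G_n)] -/
theorem foldr_span_subset_ringClassGalOver_one (hK : IsImaginaryQuadratic K) (ι : K →+* ℂ) {n : ℕ} (hn : n ≠ 0)
    {σ : ℕ → (ringClassField K ι n ≃ₐ[ℚ] ringClassField K ι n)}
    (hσ : ∀ ℓ ∈ n.primeFactors, Subgroup.zpowers (σ ℓ) = ringClassGalOver ι n (n / ℓ))
    (L : List ℕ) (hmem : ∀ ℓ ∈ L, ℓ ∈ n.primeFactors) :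
    ∀ g ∈ L.foldr (fun ℓ T ↦ (range (ℓ + 1) ×ˢ T).image (fun p ↦ σ ℓ ^ p.1 * p.2)) {1},
      g ∈ ringClassGalOver ι n 1 := by
  induction L with
  | nil =>
    intro g hg
    simp only [List.foldr_nil, Finset.mem_singleton] at hg
    rw [hg]
    exact one_mem _
  | cons ℓ L ih =>
    intro g hg
    rw [List.foldr_cons, Finset.mem_image] at hg
    obtain ⟨⟨i, t⟩, hit, rfl⟩ := hg
    rw [Finset.mem_product] at hit
    have ht := ih (fun q hq ↦ hmem q (List.mem_cons_of_mem ℓ hq)) t hit.2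
    have hℓ := hmem ℓ List.mem_cons_self
    have hle : ringClassGalOver ι n (n / ℓ) ≤ ringClassGalOver ι n 1 :=
      ringClassGalOver_le_of_le ι n (ringClassField_mono hK ι (one_dvd _)
        (Nat.div_ne_zero_iff_of_dvd (Nat.dvd_of_mem_primeFactors hℓ) |>.mpr
          ⟨hn, (Nat.prime_of_mem_primeFactors hℓ).ne_zero⟩))
    have hσi : σ ℓ ^ i ∈ ringClassGalOver ι n (n / ℓ) := by
      rw [← hσ ℓ hℓ]; exact Subgroup.npow_mem_zpowers _ i
    exact Subgroup.mul_mem _ (hle hσi) ht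

/-- **GENERATION: `Gal(K[n]/K[n/m]) ⊆ SPAN σ (prime factors of m)`** for `m ∣ n` (`n` square-free, all prime factors
inert, `d_K < −4`): every automorphism of `K[n]` over `K[n/m]` is a product `∏_{ℓ∣m} σ_ℓ^{i_ℓ}` with `i_ℓ ≤ ℓ`. Induction on
the prime factors of `m`: `Gal(K[n]/K[n/(qm′)]) ≤ G_q · Gal(K[n]/K[n/m′])` is the Galois side (x11b3's
`exists_mul_eq_of_mem_ringClassGalOver`, Artin isomorphism) of the ring-class-GROUP tower lemma `ker(→ m/q) ≤ ker(→ n/q)·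
ker(→ m)` (lit2's `RingClass.ker_restrict_div_le_sup`, unpacked as `exists_mul_eq_of_restrict_div_eq_one`; Gross 1991 §3 /
Cox (7.27)), and `G_q = {σ_q^i : i ≤ q}` (`orderOf σ_q = q + 1`). [cite: GrossLMS1991, §3 (G_n ≃ ∏ G_ℓ)] [cite: Cox2013, §7.D (7.27)] -/
theorem mem_foldr_span_of_mem_ringClassGalOver_div (hK : IsImaginaryQuadratic K) (ι : K →+* ℂ)
    (hD : NumberField.discr K < -4) {n : ℕ} (hn : Squarefree n)
    (hinert : ∀ ℓ ∈ n.primeFactors, (Ideal.span {(ℓ : 𝓞 K)}).IsPrime)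
    {σ : ℕ → (ringClassField K ι n ≃ₐ[ℚ] ringClassField K ι n)}
    (hσ : ∀ ℓ ∈ n.primeFactors, Subgroup.zpowers (σ ℓ) = ringClassGalOver ι n (n / ℓ))
    (L : List ℕ) (hL : L.Nodup) (hmem : ∀ ℓ ∈ L, ℓ ∈ n.primeFactors) :
    ∀ g ∈ ringClassGalOver ι n (n / L.prod),
      g ∈ L.foldr (fun ℓ T ↦ (range (ℓ + 1) ×ˢ T).image (fun p ↦ σ ℓ ^ p.1 * p.2)) {1} := by
  have hn0 : n ≠ 0 := hn.ne_zero
  induction L with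
  | nil =>
    intro g hg
    simp only [List.prod_nil, Nat.div_one, List.foldr_nil, Finset.mem_singleton] at hg ⊢
    have hfix := (_root_.mem_fixingSubgroup_iff (M := ringClassField K ι n ≃ₐ[ℚ] ringClassField K ι n)).mp hg
    ext x
    exact congrArg Subtype.val (hfix x x.2)
  | cons q L ih =>
    intro g hg
    have hL' : L.Nodup := (List.nodup_cons.mp hL).2
    have hmem' : ∀ ℓ ∈ L, ℓ ∈ n.primeFactors := fun ℓ hℓ ↦ hmem ℓ (List.mem_cons_of_mem q hℓ)
    have hq := hmem q List.mem_cons_self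
    have hqP : q.Prime := Nat.prime_of_mem_primeFactors hq
    set m' := L.prod with hm'
    have hqm'n : q * m' ∣ n := by
      have := prod_dvd_of_nodup_of_forall_mem_primeFactors hL hmem
      rwa [List.prod_cons] at this
    have hm'n : m' ∣ n := Dvd.dvd.trans (dvd_mul_left m' q) hqm'n
    have hqm' : ¬ q ∣ m' := not_dvd_prod_of_nodup_cons hL hmem
    -- `q ∣ n / m'`
    have hqd : q ∣ n / m' := by
      obtain ⟨c, hc⟩ := hqm'n
      have : n / m' = q * c := by
        rw [hc, mul_comm q m', mul_assoc, Nat.mul_div_cancel_left _ (Nat.pos_of_ne_zero fun h ↦ hn0 (by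
          rw [hc, h]; ring))]
      rw [this]; exact dvd_mul_right q c
    have hmn : n / m' ∣ n := Nat.div_dvd_of_dvd hm'n
    -- the Galois-side splitting `Gal(K[n]/K[(n/m')/q]) ≤ G_q · Gal(K[n]/K[n/m'])`
    have hG1 := exists_mul_eq_of_restrict_div_eq_one (K := K) hK.1 hn hqd hmn hqP
    have hg' : g ∈ ringClassGalOver ι n (n / m' / q) := by
      rw [Nat.div_div_eq_div_mul, mul_comm m' q]
      rw [List.prod_cons] at hg
      exact hg
    obtain ⟨y, hy, z, hz, rfl⟩ := exists_mul_eq_of_mem_ringClassGalOver hK ι hn0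
      (Nat.div_dvd_of_dvd (hqd.trans hmn)) hmn ((Nat.div_dvd_of_dvd hqd).trans hmn) hG1 hg'
    -- `y = σ_q^i` with `i ≤ q`
    have hqn' : ¬ q ∣ n / q := fun h ↦ by
      have : q * q ∣ n := by
        have := Nat.mul_dvd_mul_left q h
        rwa [Nat.mul_div_cancel' (Nat.dvd_of_mem_primeFactors hq)] at this
      exact hqP.not_isUnit (hn q this)
    have hord : orderOf (σ q) = q + 1 :=
      orderOf_eq_succ_of_zpowers_eq_ringClassGalOver hK ι hqP (hinert q hq) (Nat.dvd_of_mem_primeFactors hq) hqn'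
        hn0 (Or.inr hD) (hσ q hq)
    have hfin : IsOfFinOrder (σ q) := orderOf_pos_iff.mp (by rw [hord]; exact Nat.succ_pos q)
    rw [← hσ q hq, hfin.mem_zpowers_iff_mem_range_orderOf, hord, Finset.mem_image] at hy
    obtain ⟨i, hi, rfl⟩ := hy
    -- `z ∈ SPAN σ L` by induction
    have hz' := ih hL' hmem' z hz
    rw [List.foldr_cons, Finset.mem_image]
    exact ⟨⟨i, z⟩, Finset.mem_product.mpr ⟨hi, hz'⟩, rfl⟩

/-- **`G_n ⊆ SPAN σ (n.primeFactorsList)`**: every element of `Gal(K[n]/K[1])` is a product `∏_{ℓ∣n} σ_ℓ^{i_ℓ}`, `i_ℓ ≤ ℓ`.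
[cite: GrossLMS1991, §3 (G_n ≃ ∏ G_ℓ)] -/
theorem mem_foldr_span_of_mem_ringClassGalOver_one (hK : IsImaginaryQuadratic K) (ι : K →+* ℂ)
    (hD : NumberField.discr K < -4) {n : ℕ} (hn : Squarefree n)
    (hinert : ∀ ℓ ∈ n.primeFactors, (Ideal.span {(ℓ : 𝓞 K)}).IsPrime)
    {σ : ℕ → (ringClassField K ι n ≃ₐ[ℚ] ringClassField K ι n)}
    (hσ : ∀ ℓ ∈ n.primeFactors, Subgroup.zpowers (σ ℓ) = ringClassGalOver ι n (n / ℓ))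
    {g : ringClassField K ι n ≃ₐ[ℚ] ringClassField K ι n} (hg : g ∈ ringClassGalOver ι n 1) :
    g ∈ n.primeFactorsList.foldr (fun ℓ T ↦ (range (ℓ + 1) ×ˢ T).image (fun p ↦ σ ℓ ^ p.1 * p.2)) {1} := by
  refine mem_foldr_span_of_mem_ringClassGalOver_div hK ι hD hn hinert hσ n.primeFactorsList
    ((Nat.squarefree_iff_nodup_primeFactorsList hn.ne_zero).mp hn) (fun ℓ hℓ ↦ List.mem_toFinset.mpr hℓ) g ?_
  rw [Nat.prod_primeFactorsList hn.ne_zero, Nat.div_self (Nat.pos_of_ne_zero hn.ne_zero)]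
  exact hg

/-! ## §3 Injectivity of the multi-index parametrisation, by counting -/

/-- `#SPAN σ L ≤ ∏_{ℓ∈L} (ℓ+1)` (an iterated image of products of ranges). [folklore] -/
theorem card_foldr_span_le {G : Type*} [Group G] (σ : ℕ → G) (L : List ℕ) :
    (L.foldr (fun ℓ T ↦ (range (ℓ + 1) ×ˢ T).image (fun p ↦ σ ℓ ^ p.1 * p.2)) ({1} : Finset G)).card ≤
      (L.map (· + 1)).prod := by
  induction L with
  | nil => simp
  | cons ℓ L ih =>
    rw [List.foldr_cons, List.map_cons, List.prod_cons]
    refine le_trans Finset.card_image_le ?_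
    rw [Finset.card_product, Finset.card_range]
    exact Nat.mul_le_mul_left _ ih

/-- Peeling: if `#SPAN σ (L₁ ++ L) = ∏_{L₁ ++ L} (ℓ+1)` then `#SPAN σ L = ∏_L (ℓ+1)` (each image step can only lose
cardinality). [folklore] -/
theorem card_foldr_span_eq_of_append {G : Type*} [Group G] (σ : ℕ → G) (L₁ L : List ℕ)
    (h : ((L₁ ++ L).foldr (fun ℓ T ↦ (range (ℓ + 1) ×ˢ T).image (fun p ↦ σ ℓ ^ p.1 * p.2)) ({1} : Finset G)).card =
      ((L₁ ++ L).map (· + 1)).prod) :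
    (L.foldr (fun ℓ T ↦ (range (ℓ + 1) ×ˢ T).image (fun p ↦ σ ℓ ^ p.1 * p.2)) ({1} : Finset G)).card =
      (L.map (· + 1)).prod := by
  induction L₁ with
  | nil => simpa using h
  | cons ℓ L₁ ih =>
    apply ih
    rw [List.cons_append, List.foldr_cons, List.map_cons, List.prod_cons] at h
    refine le_antisymm (card_foldr_span_le σ (L₁ ++ L)) ?_
    have h1 := Finset.card_image_le (s := range (ℓ + 1) ×ˢ
      (L₁ ++ L).foldr (fun ℓ T ↦ (range (ℓ + 1) ×ˢ T).image (fun p ↦ σ ℓ ^ p.1 * p.2)) ({1} : Finset G))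
      (f := fun p ↦ σ ℓ ^ p.1 * p.2)
    rw [h, Finset.card_product, Finset.card_range] at h1
    exact Nat.le_of_mul_le_mul_left h1 (Nat.succ_pos ℓ)

/-- **The stage maps `(i, t) ↦ σ_ℓ^i · t` are injective on `range (ℓ+1) × SPAN σ L` for every suffix `ℓ :: L` of
`n.primeFactorsList`** (`n` square-free, inert prime factors, `d_K < −4`, `σ_ℓ` generating `G_ℓ`): uniqueness in
`G_n = ∏ G_ℓ`, obtained by COUNTING — `#G_n = ∏(ℓ+1)` (§1), `G_n ⊆ SPAN ⊆ G_n` (§2), so no image step loses cardinality.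
[cite: GrossLMS1991, §3 (G_n ≃ ∏ G_ℓ)] -/
theorem injOn_stage_of_suffix (hK : IsImaginaryQuadratic K) (ι : K →+* ℂ)
    (hD : NumberField.discr K < -4) {n : ℕ} (hn : Squarefree n)
    (hinert : ∀ ℓ ∈ n.primeFactors, (Ideal.span {(ℓ : 𝓞 K)}).IsPrime)
    {σ : ℕ → (ringClassField K ι n ≃ₐ[ℚ] ringClassField K ι n)}
    (hσ : ∀ ℓ ∈ n.primeFactors, Subgroup.zpowers (σ ℓ) = ringClassGalOver ι n (n / ℓ))
    (L₁ : List ℕ) (ℓ : ℕ) (L : List ℕ) (hsuf : n.primeFactorsList = L₁ ++ (ℓ :: L)) :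
    Set.InjOn (fun p : ℕ × (ringClassField K ι n ≃ₐ[ℚ] ringClassField K ι n) ↦ σ ℓ ^ p.1 * p.2)
      ↑(range (ℓ + 1) ×ˢ L.foldr (fun ℓ T ↦ (range (ℓ + 1) ×ˢ T).image (fun p ↦ σ ℓ ^ p.1 * p.2))
        ({1} : Finset (ringClassField K ι n ≃ₐ[ℚ] ringClassField K ι n))) := by
  have hn0 : n ≠ 0 := hn.ne_zero
  -- `#SPAN(full) = ∏(ℓ+1)`
  have hfull : (n.primeFactorsList.foldr (fun ℓ T ↦ (range (ℓ + 1) ×ˢ T).image (fun p ↦ σ ℓ ^ p.1 * p.2))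
      ({1} : Finset (ringClassField K ι n ≃ₐ[ℚ] ringClassField K ι n))).card =
      (n.primeFactorsList.map (· + 1)).prod := by
    refine le_antisymm (card_foldr_span_le σ _) ?_
    rw [← natCard_ringClassGalOver_one_eq_prod hK ι hD hn hinert, ← Nat.card_eq_finsetCard]
    refine Nat.card_le_card_of_injective
      (fun g : ringClassGalOver ι n 1 ↦ (⟨g.1, mem_foldr_span_of_mem_ringClassGalOver_one hK ι hD hn hinert hσ g.2⟩ :
        ↥(n.primeFactorsList.foldr (fun ℓ T ↦ (range (ℓ + 1) ×ˢ T).image (fun p ↦ σ ℓ ^ p.1 * p.2))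
          ({1} : Finset (ringClassField K ι n ≃ₐ[ℚ] ringClassField K ι n))))) ?_
    intro a b hab
    exact Subtype.ext (by simpa using congrArg Subtype.val hab)
  -- peel down to the suffix `ℓ :: L`, then one more step
  rw [hsuf] at hfull
  have hcons := card_foldr_span_eq_of_append σ L₁ (ℓ :: L) hfull
  have hL := card_foldr_span_eq_of_append σ (L₁ ++ [ℓ]) L (by rw [List.append_assoc, List.singleton_append]; exact hfull)
  rw [List.foldr_cons, List.map_cons, List.prod_cons] at hcons
  refine Finset.card_image_iff.mp ?_
  rw [Finset.card_product, Finset.card_range, hL]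
  exact hcons

/-! ## §4 The genus radicals `θ_ℓ = √ℓ* ∈ K[n]` and their sign table under the `σ_ℓ'` -/

/-- **THE GENUS RADICALS.** For `K` imaginary quadratic, `n` square-free with every prime factor ODD, inert in `K` and
prime to `d_K`, and generators `σ_ℓ` of the `G_ℓ = Gal(K[n]/K[n/ℓ])`: for every `ℓ ∣ n` there is `θ_ℓ ∈ K[n]` with
`θ_ℓ² = ℓ* = (−1)^{(ℓ−1)/2} ℓ`, `θ_ℓ ≠ 0`, MOVED by `σ_ℓ` (`σ_ℓ θ_ℓ = −θ_ℓ`) and FIXED by the other generators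
(`σ_ℓ' θ_ℓ = θ_ℓ`, `ℓ' ≠ ℓ`). Genus theory of the order of conductor `n`: `√ℓ* ∈ K[ℓ] ⊆ K[n/ℓ'] ⊆ K[n]`
(Cox Thm. 9.18 / §9.A / Thm. 6.1; tree `sqrt_intCast_mem_ringClassField`) while `√ℓ* ∉ K[n/ℓ]` (`ℓ` is unramified
in `K[n/ℓ]`, Cox §9.A; tree `sqrt_intCast_not_mem_ringClassField`), so the Galois correspondence for `K[n]/K` produces an
element of `G_ℓ = ⟨σ_ℓ⟩` moving `θ_ℓ`. [cite: Cox2013, Thm. 9.18, §9.A (p. 180), Thm. 6.1] [cite: GrossLMS1991, §3 (G_ℓ)] -/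
theorem exists_genusRadicals (hK : IsImaginaryQuadratic K) (ι : K →+* ℂ) {n : ℕ} (hn : Squarefree n)
    (hodd : ∀ ℓ ∈ n.primeFactors, ℓ ≠ 2) (hdisc : ∀ ℓ ∈ n.primeFactors, ¬ (ℓ : ℤ) ∣ NumberField.discr K)
    {σ : ℕ → (ringClassField K ι n ≃ₐ[ℚ] ringClassField K ι n)}
    (hσ : ∀ ℓ ∈ n.primeFactors, Subgroup.zpowers (σ ℓ) = ringClassGalOver ι n (n / ℓ)) :
    ∃ θ : ℕ → ringClassField K ι n, ∀ ℓ ∈ n.primeFactors,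
      θ ℓ ^ 2 = algebraMap ℚ (ringClassField K ι n) ((-1 : ℚ) ^ (ℓ / 2) * ℓ) ∧ θ ℓ ≠ 0 ∧ σ ℓ (θ ℓ) = -θ ℓ ∧
      ∀ ℓ' ∈ n.primeFactors, ℓ' ≠ ℓ → σ ℓ' (θ ℓ) = θ ℓ := by
  have hn0 : n ≠ 0 := hn.ne_zero
  letI : Algebra K ℂ := ι.toAlgebra
  haveI := (finiteDimensional_and_isGalois_ringClassField hK ι hn0).1
  haveI := (finiteDimensional_and_isGalois_ringClassField hK ι hn0).2
  -- pointwise construction, then `choose`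
  have key : ∀ ℓ : ℕ, ∃ θ : ringClassField K ι n, ℓ ∈ n.primeFactors →
      θ ^ 2 = algebraMap ℚ (ringClassField K ι n) ((-1 : ℚ) ^ (ℓ / 2) * ℓ) ∧ θ ≠ 0 ∧ σ ℓ θ = -θ ∧
      ∀ ℓ' ∈ n.primeFactors, ℓ' ≠ ℓ → σ ℓ' θ = θ := by
    intro ℓ
    by_cases hℓ : ℓ ∈ n.primeFactors
    swap
    · exact ⟨0, fun h ↦ (hℓ h).elim⟩
    have hℓP : ℓ.Prime := Nat.prime_of_mem_primeFactors hℓ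
    have hℓn : ℓ ∣ n := Nat.dvd_of_mem_primeFactors hℓ
    have hℓodd : ℓ % 2 = 1 := Nat.odd_iff.mp (hℓP.odd_of_ne_two (hodd ℓ hℓ))
    -- `d = ℓ*`
    set d : ℤ := (-1) ^ (ℓ / 2) * (ℓ : ℤ) with hddef
    have hd4 : d % 4 = 1 := by
      rcases Nat.odd_mod_four_iff.mp hℓodd with h1 | h3
      · have heven : Even (ℓ / 2) := ⟨ℓ / 4, by omega⟩
        rw [hddef, heven.neg_one_pow, one_mul]
        omega
      · have hodd' : Odd (ℓ / 2) := ⟨ℓ / 4, by omega⟩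
        rw [hddef, hodd'.neg_one_pow, neg_one_mul]
        omega
    have hdabs : d.natAbs = ℓ := by
      rw [hddef, Int.natAbs_mul, Int.natAbs_pow, Int.natAbs_neg, Int.natAbs_one, one_pow, one_mul,
        Int.natAbs_natCast]
    have hℓd : (ℓ : ℤ) ∣ d := ⟨(-1) ^ (ℓ / 2), by rw [hddef]; ring⟩
    have hℓ2d : ¬ (ℓ : ℤ) ^ 2 ∣ d := by
      intro h
      have h' := Int.natAbs_dvd_natAbs.mpr h
      rw [Int.natAbs_pow, Int.natAbs_natCast, hdabs] at h'
      have hle : ℓ ^ 2 ≤ ℓ := Nat.le_of_dvd hℓP.pos h'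
      nlinarith [hℓP.two_le]
    -- a complex square root of `ℓ*`, inside `K[n]`
    obtain ⟨θ₀, hθ₀⟩ := IsAlgClosed.exists_pow_nat_eq ((-1 : ℂ) ^ (ℓ / 2) * (ℓ : ℂ)) two_pos
    have hθ₀d : θ₀ ^ 2 = (d : ℂ) := by rw [hθ₀, hddef]; push_cast; ring
    have hmem : θ₀ ∈ ringClassField K ι n := sqrt_intCast_mem_ringClassField hK ι hd4 hn0 (hdabs ▸ hℓn) θ₀ hθ₀d
    set θ : ringClassField K ι n := ⟨θ₀, hmem⟩ with hθdef
    have hq : (algebraMap ℚ (ringClassField K ι n) ((-1 : ℚ) ^ (ℓ / 2) * ℓ) : ℂ) = (-1 : ℂ) ^ (ℓ / 2) * (ℓ : ℂ) := by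
      rw [eq_ratCast, SubfieldClass.coe_ratCast]
      push_cast
      rfl
    have hθsq : θ ^ 2 = algebraMap ℚ (ringClassField K ι n) ((-1 : ℚ) ^ (ℓ / 2) * ℓ) := by
      apply Subtype.ext
      rw [SubmonoidClass.coe_pow, hq]
      exact hθ₀
    have hθ0 : θ ≠ 0 := ne_zero_of_sq_eq_pStar hℓP hθsq
    refine ⟨θ, fun _ ↦ ⟨hθsq, hθ0, ?_, ?_⟩⟩
    · -- `σ_ℓ` moves `θ`: otherwise all of `G_ℓ = ⟨σ_ℓ⟩ = Gal(K[n]/K[n/ℓ])` fixes `θ`, i.e. `θ₀ ∈ K[n/ℓ]`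
      rcases algEquiv_apply_eq_or_eq_neg_of_sq_eq hθsq (σ ℓ) with h | h
      swap
      · exact h
      exfalso
      have hm0 : n / ℓ ≠ 0 := (Nat.div_ne_zero_iff_of_dvd hℓn).mpr ⟨hn0, hℓP.ne_zero⟩
      have hℓm : ¬ ℓ ∣ n / ℓ := fun h' ↦ by
        have : ℓ * ℓ ∣ n := by
          have := Nat.mul_dvd_mul_left ℓ h'
          rwa [Nat.mul_div_cancel' hℓn] at this
        exact hℓP.not_isUnit (hn ℓ this)
      have hnot : θ₀ ∉ ringClassField K ι (n / ℓ) :=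
        sqrt_intCast_not_mem_ringClassField hK ι hm0 hℓP hℓd hℓ2d hℓm (hdisc ℓ hℓ) θ₀ hθ₀d
      -- Galois correspondence over the intermediate field `K[n] ∩ K[n/ℓ]`
      let M : IntermediateField K (ringClassField K ι n) := RingClassField.subfieldIn ι n (n / ℓ)
      have hθM : ¬ ∀ τ ∈ M.fixingSubgroup, τ θ = θ := by
        rw [← IntermediateField.mem_fixedField_iff, IsGalois.fixedField_fixingSubgroup M]
        exact fun h' ↦ hnot ((RingClassField.mem_subfieldIn_iff ι n (n / ℓ) θ).mp h')
      push Not at hθM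
      obtain ⟨τ, hτM, hτθ⟩ := hθM
      have hτ' : τ.restrictScalars ℚ ∈ ringClassGalOver ι n (n / ℓ) := by
        rw [ringClassGalOver, mem_fixingSubgroup_iff]
        intro y hy
        rw [AlgEquiv.smul_def, AlgEquiv.restrictScalars_apply]
        exact (IntermediateField.mem_fixingSubgroup_iff M τ).mp hτM y
          ((RingClassField.mem_subfieldIn_iff ι n (n / ℓ) y).mpr hy)
      -- every element of `⟨σ_ℓ⟩` fixes `θ` (the stabiliser is a subgroup)
      have hstab : σ ℓ ∈ MulAction.stabilizer (ringClassField K ι n ≃ₐ[ℚ] ringClassField K ι n) θ := by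
        rw [MulAction.mem_stabilizer_iff, AlgEquiv.smul_def]; exact h
      have hfix := (Subgroup.zpowers_le.mpr hstab) (hσ ℓ hℓ ▸ hτ')
      rw [MulAction.mem_stabilizer_iff, AlgEquiv.smul_def, AlgEquiv.restrictScalars_apply] at hfix
      exact hτθ hfix
    · -- `σ_ℓ'` (`ℓ' ≠ ℓ`) fixes `θ`: `θ₀ ∈ K[n/ℓ']` and `σ_ℓ' ∈ Gal(K[n]/K[n/ℓ'])`
      intro ℓ' hℓ' hne
      have hℓ'P : ℓ'.Prime := Nat.prime_of_mem_primeFactors hℓ'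
      have hℓ'n : ℓ' ∣ n := Nat.dvd_of_mem_primeFactors hℓ'
      have hm0 : n / ℓ' ≠ 0 := (Nat.div_ne_zero_iff_of_dvd hℓ'n).mpr ⟨hn0, hℓ'P.ne_zero⟩
      have hℓm' : ℓ ∣ n / ℓ' := by
        have hcop : Nat.Coprime ℓ ℓ' := (Nat.coprime_primes hℓP hℓ'P).mpr (Ne.symm hne)
        exact Nat.Coprime.dvd_of_dvd_mul_left hcop (by rw [Nat.mul_div_cancel' hℓ'n]; exact hℓn)
      have hmem' : θ₀ ∈ ringClassField K ι (n / ℓ') :=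
        sqrt_intCast_mem_ringClassField hK ι hd4 hm0 (hdabs ▸ hℓm') θ₀ hθ₀d
      have hσ' : σ ℓ' ∈ ringClassGalOver ι n (n / ℓ') := by
        rw [← hσ ℓ' hℓ']; exact Subgroup.mem_zpowers (σ ℓ')
      have hfix := (_root_.mem_fixingSubgroup_iff
        (M := ringClassField K ι n ≃ₐ[ℚ] ringClassField K ι n)).mp hσ' θ hmem'
      rwa [AlgEquiv.smul_def] at hfix
  choose θ hθ using key
  exact ⟨θ, fun ℓ hℓ ↦ hθ ℓ hℓ⟩

end Summit.BirchSwinnertonDyer.BirchSwinnertonDyer.Theorems.GenusKoly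

end
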